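import Literature.AnabelianGeometry.EtaleTheta.Discharge.Sec2Prop214iiiBiUpperOfModel
import Literature.AnabelianGeometry.EtaleTheta.ThetaCohomologyZHatLog
import Literature.AnabelianGeometry.EtaleTheta.LDeltaThetaIndex
import Literature.AnabelianGeometry.EtaleTheta.ThetaCovers
import Mathlib.Algebra.Group.Subgroup.Pointwise
import HarnessLib

/-!
# [EtTh] Prop 2.14 (iii), BI-theta UPPER bound: the binder `hU` (GAP G-L2t2-3) FROM PRINT'S «F̈¹/F̈² = Ẑ·log(Ü)»
# (abc-iut-L2-t1's typed `Prop15iiQuot`) and «Δ̄_Θ ≅ (ℤ/lℤ)(1)» (`CyclotomeMod 1 l`) — proof-only companion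

Mochizuki, *The Étale Theta Function and its Frobenioid-theoretic Manifestations* [EtTh], Publ. RIMS 45 (2009),
§1 Prop 1.5 (ii) p.23 («F̈¹/F̈² = Hom((Δ^tp_Ÿ)^ell/Δ_Θ, Δ_Θ) = Ẑ·log(Ü)», «log(U) … the standard isomorphism
(Δ^tp_Y)^ell/Δ_Θ ⥲ Ẑ(1) ⥲ Δ_Θ»), §2 Def 2.1 p.35 («Δ̄_Θ ≅ (ℤ/lℤ)(1)»), Prop 2.2 (ii) p.37, Def 2.5 (i) p.39, p.41
(«Ÿ̲̲ → Ÿ … of degree l»), Prop 2.14 (iii) p.51 (locators `p.N` = PDF pages of the PRIMS text; bib key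
`MochizukiEtTh2009`). PROOF-ONLY companion (no `def`; seat abc-iut-L2-t2 gen 6, row «P214iii-BI-UPPER», part 4):
the binder `hU` of parts 1–3 («log(Ü) maps the geometric part `Δ^tp_Ÿ̲̲` onto `Δ_Θ`», GAP row G-L2t2-3) is
DERIVED from named typed §1/§2 inputs only:

* abc-iut-L2-t1's `ThetaSetting.Prop15iiQuot E.toKummerData hC` (`ThetaCohomologyZHatLog.lean`: a continuous
  `λ : (Δ^tp_Ÿ)^Θ ↠ Δ_Θ` with kernel `Δ_Θ` — «the standard isomorphism» — and `res_{(Δ^tp_Ÿ)^Θ} log(Ü) = [λ]`);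
* abc-iut-L2-t8's `CyclotomeMod 1 l` («Δ̄_Θ ≅ (ℤ/lℤ)(1)»: `[Δ_Θ : l·Δ_Θ] = l`, abc-iut-L2-t7's
  `index_lDeltaTheta_of_cyclotomeMod`);
* the `DoubleUnderline` axioms of `X̲̲` (abc-iut-L2-t8): «`Y̲̲ → Y` of degree `l`» (`relIndex_Huu_GtpY`) and
  «`θ(Π^tp_X̲̲) ∩ Δ_Θ = l·Δ_Θ`» (`map_toTheta_Huu`, Prop 2.2 (ii) / 2.12 (i)).

THE ARGUMENT (a diamond of indices in `Π^tp_X`; print: "`Δ_X̲̲ = Im(s_ι)` maps isomorphically onto `Δ̄^ell_X`",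
Prop 2.2 (ii) — i.e. passing from `Ÿ` to `Ÿ̲̲` costs index `l` in the `Δ_Θ`-direction ONLY). Put
`A := Δ^tp_Ÿ = Π^tp_Ÿ ∩ Δ^tp_X`, `B := A ∩ Π^tp_X̲̲ = Δ^tp_Ÿ̲̲`, `K := A ∩ θ⁻¹(Δ_Θ)` (normal). Then `[A : B] ≤
[Π^tp_Y : Π^tp_Y ∩ Π^tp_X̲̲] = l`; `θ(K) = Δ_Θ` (`Δ_Θ ≤ (Δ^tp_Ÿ)^Θ`, `Compat`) while `θ(B ∩ K) ⊆ θ(Π^tp_X̲̲) ∩ Δ_Θ =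
l·Δ_Θ`, so `l = [Δ_Θ : l·Δ_Θ]` divides `[K : B ∩ K] = [B·K : B]` (the second-isomorphism count `|BK/B| = |K/(B ∩ K)|`,
this seat's g0 `ThetaCovers.CoverData.relIndex_sup_eq_relIndex_of_normal`); as `[A : B] = [A : B·K]·[B·K : B] ≤ l`,
`B·K = A`.
Hence every `a ∈ Δ^tp_Ÿ` is `b·k` with `b ∈ Δ^tp_Ÿ̲̲`, `θ(k) ∈ Δ_Θ = Ker λ`, and `λ(θ a) = λ(θ b)`: `λ` — which IS
`log(Ü)` pointwise on `(Δ^tp_Ÿ)^Θ` (coboundaries vanish on the centraliser of `Δ_Θ`) — maps `Δ^tp_Ÿ̲̲` ONTO `Δ_Θ`.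

* **`DoubleUnderline.exists_logUdd_rep_geometric_surjective_of_prop15iiQuot`** — G-L2t2-3 ⟸ `Prop15iiQuot` +
  `CyclotomeMod 1 l` (+ `Compat`).
* **`DoubleUnderline.ndag_mul_dvd_toZ_of_biIso_over_conj_of_prop15iiQuot`** — the upper bound of
  `Sec2Prop214iiiBiUpperOfModel` with binders BY NAME ONLY: `Prop15iii`, `Prop15ii`, `Prop15iiQuot` (abc-iut-L2-t1),
  `CyclotomeMod 1 l` (abc-iut-L2-t8): an automorphism of `B_N(η)` inducing the translation by `x ∈ Π^tp_X̲̲` on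
  `Π^tp_Y̲̲` forces `N ∣ 2·zExp(x)` and `N†·l ∣ toZ(x)` ("for any `a·l ∈ Im_N`, `2a ≡ 0 (mod N)`", p.51).
HONEST FRAMING: [EtTh] is refereed; these are OUR kernel checks at the cell's §1 objects, conditional on the named
§1 facts (`Prop15ii`, `Prop15iiQuot`, `Prop15iii` are abc-iut-L2-t1's typed predicates, not proved here); no side is
taken on [IUTchIII] Cor 3.12; typed ≠ proved.
-/

noncomputable section

open scoped Pointwise

namespace Literature.AnabelianGeometry.EtaleTheta

open Literature.AnabelianGeometry.SemiGraphs
open scoped IsMulCommutative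

namespace ThetaSetting.EtaleThetaData.DoubleUnderline

variable {p : ℕ} [Fact p.Prime] {D : ThetaSetting p} {E : D.EtaleThetaData} {l : ℕ+}
  (C : E.DoubleUnderline l) {N : ℕ+} (μ : D.CyclotomeMod l N)

/-- **`(Δ^tp_Ÿ̲̲)·θ⁻¹(Δ_Θ) = Δ^tp_Ÿ`** (inside `Π^tp_X`): every element of `Δ^tp_Ÿ = Π^tp_Ÿ ∩ Δ^tp_X` is the product of an
element of `Δ^tp_Ÿ̲̲ = Δ^tp_Ÿ ∩ Π^tp_X̲̲` and an element of `Δ^tp_Ÿ` mapping into `Δ_Θ` — the diamond of indices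
`[Δ^tp_Ÿ : Δ^tp_Ÿ̲̲] ≤ l` («`Y̲̲ → Y` of degree `l`», p.41) and `l = [Δ_Θ : l·Δ_Θ] ∣ [K : Δ^tp_Ÿ̲̲ ∩ K]`
(«`θ(Π^tp_X̲̲) ∩ Δ_Θ = l·Δ_Θ`», Prop 2.2 (ii); «`Δ̄_Θ ≅ (ℤ/lℤ)(1)`», Def 2.1). [cite: MochizukiEtTh2009, Prop 2.2 (ii) p.37] -/
theorem dtpYdd_le_huu_inf_sup_thetaPreimage (hC : D.Compat) (μ₁ : D.CyclotomeMod 1 l) :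
    D.DtpYddN 1 ≤ (C.Huu ⊓ D.DtpYddN 1) ⊔ ((D.thetaToEll.comp D.toTheta).ker ⊓ D.DtpYddN 1) := by
  haveI := hC.GtpYdd_normal
  haveI hA : (D.DtpYddN 1).Normal := by
    haveI : (D.GtpYddN 1).Normal := hC.GtpYdd_normal
    haveI : D.DeltaTemp.Normal := inferInstanceAs D.aug.toMonoidHom.ker.Normal
    exact Subgroup.normal_inf_normal _ _
  haveI hK : ((D.thetaToEll.comp D.toTheta).ker ⊓ D.DtpYddN 1).Normal := Subgroup.normal_inf_normal _ _
  -- (1) `[Δ^tp_Ÿ : Δ^tp_Ÿ̲̲] ≤ l`, finite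
  have hl : C.Huu.relIndex D.GtpY = l := by
    rw [← Subgroup.inf_relIndex_right]; exact C.relIndex_Huu_GtpY
  have hl0 : C.Huu.relIndex D.GtpY ≠ 0 := by rw [hl]; exact l.ne_zero
  have hAY : D.DtpYddN 1 ≤ D.GtpY := fun x hx => D.GtpYdd_le_GtpY (Subgroup.mem_inf.1 hx).1
  have h1 : (C.Huu ⊓ D.DtpYddN 1).relIndex (D.DtpYddN 1) ≤ l := by
    rw [Subgroup.inf_relIndex_right]
    exact (Subgroup.relIndex_le_of_le_right hAY hl0).trans hl.le
  have h1' : (C.Huu ⊓ D.DtpYddN 1).relIndex (D.DtpYddN 1) ≠ 0 := by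
    rw [Subgroup.inf_relIndex_right]
    exact fun h0 => hl0 (Subgroup.relIndex_eq_zero_of_le_right hAY h0)
  -- (2) `θ(K) = Δ_Θ`
  have hmapK : ((D.thetaToEll.comp D.toTheta).ker ⊓ D.DtpYddN 1).map D.toTheta = D.DeltaTheta := by
    apply le_antisymm
    · rintro _ ⟨k, hk, rfl⟩
      exact (Subgroup.mem_inf.1 hk).1
    · intro z hz
      obtain ⟨a, ha, haz⟩ := hC.deltaTheta_le_DtpYddTheta hz
      refine ⟨a, Subgroup.mem_inf.2 ⟨?_, ha⟩, haz⟩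
      rw [MonoidHom.mem_ker, MonoidHom.comp_apply, haz]
      exact hz
  -- (3) `l ∣ [K : Δ^tp_Ÿ̲̲ ∩ K]`
  have hsub : (C.Huu ⊓ D.DtpYddN 1) ⊓ ((D.thetaToEll.comp D.toTheta).ker ⊓ D.DtpYddN 1) ≤
      (D.lDeltaTheta l).comap D.toTheta := by
    intro x hx
    rw [Subgroup.mem_comap, ← C.map_toTheta_Huu]
    refine Subgroup.mem_inf.2 ⟨⟨x, (Subgroup.mem_inf.1 (Subgroup.mem_inf.1 hx).1).1, rfl⟩, ?_⟩
    exact (Subgroup.mem_inf.1 (Subgroup.mem_inf.1 hx).2).1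
  have hdiv : (l : ℕ) ∣ (C.Huu ⊓ D.DtpYddN 1).relIndex ((D.thetaToEll.comp D.toTheta).ker ⊓ D.DtpYddN 1) := by
    have h := Subgroup.relIndex_dvd_of_le_left ((D.thetaToEll.comp D.toTheta).ker ⊓ D.DtpYddN 1) hsub
    rw [Subgroup.inf_relIndex_right, Subgroup.relIndex_comap, hmapK] at h
    have hidx : (D.lDeltaTheta l).relIndex D.DeltaTheta = l := index_lDeltaTheta_of_cyclotomeMod μ₁
    rwa [hidx] at h
  -- (4) the diamond: `[A : B·K] = 1`
  have hBM : C.Huu ⊓ D.DtpYddN 1 ≤ (C.Huu ⊓ D.DtpYddN 1) ⊔ ((D.thetaToEll.comp D.toTheta).ker ⊓ D.DtpYddN 1) :=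
    le_sup_left
  have hMA : (C.Huu ⊓ D.DtpYddN 1) ⊔ ((D.thetaToEll.comp D.toTheta).ker ⊓ D.DtpYddN 1) ≤ D.DtpYddN 1 :=
    sup_le inf_le_right inf_le_right
  have hmul := Subgroup.relIndex_mul_relIndex _ _ _ hBM hMA
  rw [ThetaCovers.CoverData.relIndex_sup_eq_relIndex_of_normal] at hmul
  obtain ⟨q, hq⟩ := hdiv
  rw [hq, mul_assoc] at hmul
  -- `l * (q * r) = [A : B] ≤ l`, nonzero
  have hle : (l : ℕ) * (q * ((C.Huu ⊓ D.DtpYddN 1) ⊔ ((D.thetaToEll.comp D.toTheta).ker ⊓ D.DtpYddN 1)).relIndex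
      (D.DtpYddN 1)) ≤ l * 1 := by rw [mul_one, hmul]; exact h1
  have hne : q * ((C.Huu ⊓ D.DtpYddN 1) ⊔ ((D.thetaToEll.comp D.toTheta).ker ⊓ D.DtpYddN 1)).relIndex
      (D.DtpYddN 1) ≠ 0 := by
    intro h0
    apply h1'
    rw [← hmul, h0, mul_zero]
  have hqr : q * ((C.Huu ⊓ D.DtpYddN 1) ⊔ ((D.thetaToEll.comp D.toTheta).ker ⊓ D.DtpYddN 1)).relIndex
      (D.DtpYddN 1) = 1 := by
    have := Nat.le_of_mul_le_mul_left hle l.pos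
    omega
  exact Subgroup.relIndex_eq_one.1 (Nat.eq_one_of_mul_eq_one_left hqr)

/-- **GAP G-L2t2-3 FROM `Prop15iiQuot` (print's «F̈¹/F̈² = Ẑ·log(Ü)») and `CyclotomeMod 1 l` («Δ̄_Θ ≅ (ℤ/lℤ)(1)»).**
For `X̲̲` a `DoubleUnderline l` of the étale-theta datum `E` over the §1 setting: if `Prop15iiQuot E hC` holds
(abc-iut-L2-t1: `λ : (Δ^tp_Ÿ)^Θ ↠ Δ_Θ` the standard logarithm with `res log(Ü) = [λ]`) and a level-`(1,l)` cyclotome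
identification is given, then SOME cocycle of `log(Ü)` on `(Π^tp_Ÿ)^Θ` (indeed any: it equals `λ` pointwise on
`(Δ^tp_Ÿ)^Θ`, where coboundaries vanish) maps the geometric part `Δ^tp_Ÿ̲̲` ONTO `Δ_Θ` — the `N`-free binder `hU` of
`ndag_mul_dvd_toZ_of_biIso_over_conj`. Proof: `λ` is onto from `(Δ^tp_Ÿ)^Θ`; by
`dtpYdd_le_huu_inf_sup_thetaPreimage` every `a ∈ Δ^tp_Ÿ` is `b·k` with `b ∈ Δ^tp_Ÿ̲̲`, `θ(k) ∈ Δ_Θ = Ker λ`.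
[cite: MochizukiEtTh2009, Prop 1.5 (ii) p.23] -/
theorem exists_logUdd_rep_geometric_surjective_of_prop15iiQuot (hC : D.Compat)
    (hQ : Prop15iiQuot E.toKummerData hC) (μ₁ : D.CyclotomeMod 1 l) :
    ∃ c : contCocycles (MonoidHom.id D.GtpTheta) D.DeltaTheta (D.GtpYdd.map D.toTheta),
      (QuotientGroup.mk c : D.H1Theta (D.GtpYdd.map D.toTheta)) = E.logUdd ∧
      ∀ z : D.DeltaTheta, ∃ (g : C.GtpYdduu) (_ : (g : D.PiTemp) ∈ D.DeltaTemp),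
        c.1 ⟨D.toTheta g, ⟨g, (Subgroup.mem_inf.1 g.2).1, rfl⟩⟩ = z := by
  haveI := hC.GtpYdd_normal
  haveI hK : ((D.thetaToEll.comp D.toTheta).ker ⊓ D.DtpYddN 1).Normal := by
    haveI : (D.DtpYddN 1).Normal := by
      haveI : (D.GtpYddN 1).Normal := hC.GtpYdd_normal
      haveI : D.DeltaTemp.Normal := inferInstanceAs D.aug.toMonoidHom.ker.Normal
      exact Subgroup.normal_inf_normal _ _
    exact Subgroup.normal_inf_normal _ _
  obtain ⟨lam, hstd, hspec⟩ := hQ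
  obtain ⟨c, hc⟩ := QuotientGroup.mk_surjective E.logUdd
  -- `c = λ` pointwise on `(Δ^tp_Ÿ)^Θ`
  have hres : (QuotientGroup.mk (ContH1.resCocycle (MonoidHom.id D.GtpTheta) D.DeltaTheta
      (Subgroup.map_mono inf_le_left : (D.DtpYddN 1).map D.toTheta ≤ D.GtpYdd.map D.toTheta) c) :
        D.H1Theta ((D.DtpYddN 1).map D.toTheta)) =
      QuotientGroup.mk ⟨fun h => lam h, hom_mem_contCocycles dtpYddTheta_le_deltaTheta_map lam⟩ := by
    have h := hspec.res_logUdd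
    rw [← hc] at h
    exact h
  obtain ⟨a, ha⟩ := ContH1.exists_coboundary_of_mk_eq _ _ hres
  refine ⟨c, hc, fun z => ?_⟩
  -- `z = λ(θ a₁)`, `a₁ ∈ Δ^tp_Ÿ`, and `a₁ = b·k`
  obtain ⟨a₀, ha₀⟩ := hstd.surjective z
  obtain ⟨a₁, ha₁A, ha₁⟩ := a₀.2
  have ha₁M : a₁ ∈ (↑((C.Huu ⊓ D.DtpYddN 1) ⊔ ((D.thetaToEll.comp D.toTheta).ker ⊓ D.DtpYddN 1)) :
      Set D.PiTemp) := C.dtpYdd_le_huu_inf_sup_thetaPreimage hC μ₁ ha₁A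
  rw [Subgroup.mul_normal] at ha₁M
  obtain ⟨b, hb, k, hk, hbk⟩ := Set.mem_mul.1 ha₁M
  have hbA : b ∈ D.DtpYddN 1 := (Subgroup.mem_inf.1 hb).2
  have hbA' : b ∈ D.GtpYddN 1 ⊓ D.DeltaTemp := hbA
  have hkA : k ∈ D.DtpYddN 1 := (Subgroup.mem_inf.1 hk).2
  have hkΔ : D.toTheta k ∈ D.DeltaTheta := (Subgroup.mem_inf.1 hk).1
  refine ⟨⟨b, Subgroup.mem_inf.2 ⟨(Subgroup.mem_inf.1 hbA').1, (Subgroup.mem_inf.1 hb).1⟩⟩,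
    (Subgroup.mem_inf.1 hbA').2, ?_⟩
  have e1 : lam ⟨D.toTheta b, ⟨b, hbA, rfl⟩⟩ = z := by
    rw [← ha₀]
    have e0 : a₀ = ⟨D.toTheta b, ⟨b, hbA, rfl⟩⟩ * ⟨D.toTheta k, ⟨k, hkA, rfl⟩⟩ := by
      apply Subtype.ext
      change (a₀ : D.GtpTheta) = D.toTheta b * D.toTheta k
      rw [← ha₁, ← hbk, map_mul]
    rw [e0, map_mul, (hstd.ker_iff ⟨D.toTheta k, ⟨k, hkA, rfl⟩⟩).2 hkΔ, mul_one]
  have e2 := ha ⟨D.toTheta b, ⟨b, hbA, rfl⟩⟩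
  rw [MonoidHom.id_apply, conjNormal_deltaTheta_eq_self (dtpYddTheta_le_deltaTheta_map ⟨b, hbA, rfl⟩),
    mul_inv_cancel, mul_one] at e2
  -- `e2 : λ(θ b) = c(θ b)`
  have e3 : lam ⟨D.toTheta b, ⟨b, hbA, rfl⟩⟩ =
      c.1 ⟨D.toTheta b, ⟨b, (Subgroup.mem_inf.1 hbA').1, rfl⟩⟩ := e2
  rw [← e1, e3]

/-- **[EtTh] Prop 2.14 (iii), BI-theta UPPER bound at the §1 model with ALL binders BY NAME**: for
`R = C.rigidData μ hC hS h15 L` and every theta cocycle `η`, an automorphism of `B_N(η)` inducing the translation by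
`x ∈ Π^tp_X̲̲` on `Π^tp_Y̲̲` forces `N ∣ 2·zExp(x)` and `N†·l ∣ toZ(x)` — GIVEN abc-iut-L2-t1's typed §1 facts `Prop15iii`
(inside `R`), `Prop15ii` (`F̈² = ` Kummer classes) and `Prop15iiQuot` («F̈¹/F̈² = Ẑ·log(Ü)»), and abc-iut-L2-t8's
level-`(1,l)` cyclotome identification `CyclotomeMod 1 l` («Δ̄_Θ ≅ (ℤ/lℤ)(1)»); print: "for any `a·l ∈ Im_N` [where
`a ∈ ℤ`], we have `2a ≡ 0 (mod N)`". [cite: MochizukiEtTh2009, Prop 2.14(iii) p.51] -/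
theorem ndag_mul_dvd_toZ_of_biIso_over_conj_of_prop15iiQuot (hC : D.Compat) (hS : D.Sec2Hyps)
    (h15 : Prop15iii E hC) (h15ii : Prop15ii E.toKummerData hC) (hQ : Prop15iiQuot E.toKummerData hC)
    (μ₁ : D.CyclotomeMod 1 l) (L : C.CuspLabels)
    {η : D.GtpYdd.subgroupOf C.Huu → MuN p N} (hη : η ∈ C.thetaCocycles hC μ) (x : C.Huu)
    (α : ((C.rigidData μ hC hS h15 L).modelBi hη).Iso ((C.rigidData μ hC hS h15 L).modelBi hη))
    (hα : ∀ z, ((CycEnvelope.proj (C.rigidData μ hC hS h15 L).augY (C.rigidData μ hC hS h15 L).chi (α.e z) :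
          (C.rigidData μ hC hS h15 L).PiY) : C.Huu) =
        x * ((CycEnvelope.proj (C.rigidData μ hC hS h15 L).augY (C.rigidData μ hC hS h15 L).chi z :
          (C.rigidData μ hC hS h15 L).PiY) : C.Huu) * x⁻¹) :
    (N : ℤ) ∣ 2 * C.zExp x ∧
      (if Odd (N : ℕ) then (N : ℤ) else (N : ℤ) / 2) * l ∣ Multiplicative.toAdd (D.toZ (x : D.PiTemp)) :=
  C.ndag_mul_dvd_toZ_of_biIso_over_conj μ hC hS h15 h15ii L
    (C.exists_logUdd_rep_geometric_surjective_of_prop15iiQuot hC hQ μ₁) hη x α hα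

end ThetaSetting.EtaleThetaData.DoubleUnderline

end Literature.AnabelianGeometry.EtaleTheta

end
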